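import Summits.Ventures.PercRepro.S1FiveCircuitsThroughChoose

/-!
# PercRepro — THE SIX-CIRCUIT SPLIT, DOUBLE COUNT AND AVERAGING, AND `#6circ(e) ≤ C(ν + 4, 5)` BY CONTRACTION (p1, gen 33)

`proofs/P1-S2-CORANK6.md` §4j (3). p2's S1FiveCircuitChain transposed to the six-circuits, verbatim in the proofs: the 6-circuits of `M` are
those through `e` plus those of `M ＼ {e}` (`ncard_sixCircuits_le_through_add_delete`); over the points they sum to `6·s₆`
(`sum_ncard_sixCircuitsThrough_eq`); coloops lie on none (`ncard_sixCircuitsThrough_eq_zero_of_isColoop`); so some non-coloop lies on at most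
`⌊6·s₆/m⌋` of them (`exists_nonColoop_ncard_sixCircuitsThrough_le`); and `s − ⌊6s/m⌋ ≤ B ⟹ s ≤ ⌊m·B/(m − 6)⌋` (`le_mul_div_of_sub_div_le_six`).
Plus the per-point crude bound by contraction (the pattern of S1FiveCircuitsThroughChoose at size six): **`#{six-circuits through e} ≤ C(ν + 4, 5)`**
on every finite matroid of nullity `ν` (`ncard_sixCircuitsThrough_le_choose`: `1, 6, 21, 56, 126` at `ν = 1 … 5`, tight on `U_{5, ν+5}`) — the first
three entries of the per-point `s₆` table. The spread chain for `s₆` modulo its table is S1CoreCapSpreadChainSixCircuits.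
Axioms: standard.
-/

open scoped Matroid

namespace PercRepro

namespace S1

open Set

variable {α : Type}

/-- The 6-circuits of `M` are at most those through `e` plus those of `M ＼ {e}` (p1's `S1CoreSplit` for size `6`). -/
theorem ncard_sixCircuits_le_through_add_delete (M : Matroid α) [M.Finite] (e : α) :
    {C : Set α | M.IsCircuit C ∧ C.ncard = 6}.ncard ≤
      {C : Set α | M.IsCircuit C ∧ C.ncard = 6 ∧ e ∈ C}.ncard +
        {C : Set α | (M ＼ {e}).IsCircuit C ∧ C.ncard = 6}.ncard := by
  classical
  set S := {C : Set α | M.IsCircuit C ∧ C.ncard = 6} with hS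
  set S₁ := {C : Set α | M.IsCircuit C ∧ C.ncard = 6 ∧ e ∈ C} with hS₁
  set S₂ := {C : Set α | (M ＼ {e}).IsCircuit C ∧ C.ncard = 6} with hS₂
  have hS₁fin : S₁.Finite :=
    M.ground_finite.finite_subsets.subset (fun C hC => hC.1.subset_ground)
  have hS₂fin : S₂.Finite :=
    (M ＼ {e}).ground_finite.finite_subsets.subset (fun C hC => hC.1.subset_ground)
  have hsplit : S ⊆ S₁ ∪ S₂ := by
    intro C hC
    by_cases h : e ∈ C
    · exact Or.inl ⟨hC.1, hC.2, h⟩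
    · exact Or.inr ⟨_root_.Matroid.delete_isCircuit_iff.2 ⟨hC.1, disjoint_singleton_right.2 h⟩, hC.2⟩
  calc S.ncard ≤ (S₁ ∪ S₂).ncard := ncard_le_ncard hsplit (hS₁fin.union hS₂fin)
    _ ≤ S₁.ncard + S₂.ncard := ncard_union_le _ _

open Classical in
/-- **Double count**: over the points of the ground set, the 6-circuits through a point sum to `6 · s₆`. -/
theorem sum_ncard_sixCircuitsThrough_eq (M : Matroid α) [M.Finite] :
    ∑ x ∈ M.ground_finite.toFinset, {C : Set α | M.IsCircuit C ∧ C.ncard = 6 ∧ x ∈ C}.ncard =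
      6 * {C : Set α | M.IsCircuit C ∧ C.ncard = 6}.ncard := by
  have hS : {C : Set α | M.IsCircuit C ∧ C.ncard = 6}.Finite :=
    M.ground_finite.finite_subsets.subset (fun C hC => hC.1.subset_ground)
  set Sf := hS.toFinset with hSf
  have h1 : ∀ x, {C : Set α | M.IsCircuit C ∧ C.ncard = 6 ∧ x ∈ C}.ncard = (Sf.filter (fun C => x ∈ C)).card := by
    intro x
    rw [← ncard_coe_finset]
    congr 1
    ext C
    simp only [Finset.coe_filter, hSf, Set.Finite.mem_toFinset, mem_setOf_eq]
    tauto
  have h2 : ∀ C ∈ Sf, (M.ground_finite.toFinset.filter (fun x => x ∈ C)).card = 6 := by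
    intro C hC
    rw [hSf, Set.Finite.mem_toFinset] at hC
    have : (M.ground_finite.toFinset.filter (fun x => x ∈ C) : Set α) = C := by
      ext x
      simp only [Finset.coe_filter, Set.Finite.mem_toFinset, mem_setOf_eq]
      exact ⟨fun h => h.2, fun h => ⟨hC.1.subset_ground h, h⟩⟩
    rw [← ncard_coe_finset, this, hC.2]
  calc ∑ x ∈ M.ground_finite.toFinset, {C : Set α | M.IsCircuit C ∧ C.ncard = 6 ∧ x ∈ C}.ncard
      = ∑ x ∈ M.ground_finite.toFinset, ∑ C ∈ Sf, (if x ∈ C then 1 else 0) := by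
        refine Finset.sum_congr rfl (fun x _ => ?_); rw [h1 x, Finset.card_filter]
    _ = ∑ C ∈ Sf, ∑ x ∈ M.ground_finite.toFinset, (if x ∈ C then 1 else 0) := Finset.sum_comm
    _ = ∑ C ∈ Sf, 6 := by
        refine Finset.sum_congr rfl (fun C hC => ?_); rw [← Finset.card_filter, h2 C hC]
    _ = 6 * {C : Set α | M.IsCircuit C ∧ C.ncard = 6}.ncard := by
        rw [Finset.sum_const, smul_eq_mul, mul_comm, hSf, ← ncard_eq_toFinset_card _ hS]

/-- A coloop lies on no 6-circuit. -/
theorem ncard_sixCircuitsThrough_eq_zero_of_isColoop (M : Matroid α) {x : α} (hx : M.IsColoop x) :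
    {C : Set α | M.IsCircuit C ∧ C.ncard = 6 ∧ x ∈ C}.ncard = 0 := by
  have : {C : Set α | M.IsCircuit C ∧ C.ncard = 6 ∧ x ∈ C} = ∅ := by
    ext C; simp only [mem_setOf_eq, mem_empty_iff_false, iff_false]
    rintro ⟨hC, _, hxC⟩
    exact hC.not_isColoop_of_mem hxC hx
  rw [this, ncard_empty]

open Classical in
/-- **Averaging**: if `s₆ > 0`, some non-coloop `x` lies on at most `⌊6·s₆ / m⌋` six-circuits, where `m` is the
number of non-coloops. -/
theorem exists_nonColoop_ncard_sixCircuitsThrough_le (M : Matroid α) [M.Finite]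
    (hpos : 0 < {C : Set α | M.IsCircuit C ∧ C.ncard = 6}.ncard) :
    ∃ x ∈ M.E, ¬ M.IsColoop x ∧ {C : Set α | M.IsCircuit C ∧ C.ncard = 6 ∧ x ∈ C}.ncard ≤
      6 * {C : Set α | M.IsCircuit C ∧ C.ncard = 6}.ncard /
        (M.ground_finite.toFinset.filter (fun x => ¬ M.IsColoop x)).card := by
  have hS : {C : Set α | M.IsCircuit C ∧ C.ncard = 6}.Finite :=
    M.ground_finite.finite_subsets.subset (fun C hC => hC.1.subset_ground)
  have hsum : ∑ x ∈ M.ground_finite.toFinset.filter (fun x => ¬ M.IsColoop x),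
      {C : Set α | M.IsCircuit C ∧ C.ncard = 6 ∧ x ∈ C}.ncard = 6 * {C : Set α | M.IsCircuit C ∧ C.ncard = 6}.ncard := by
    rw [Finset.sum_filter_of_ne]
    · exact sum_ncard_sixCircuitsThrough_eq M
    · intro x _ hfx hcol
      exact hfx (ncard_sixCircuitsThrough_eq_zero_of_isColoop M hcol)
  -- the non-coloops are nonempty: a point of a 6-circuit
  have hm : 0 < (M.ground_finite.toFinset.filter (fun x => ¬ M.IsColoop x)).card := by
    obtain ⟨C₀, hC₀⟩ := (ncard_pos hS).1 hpos
    obtain ⟨x₀, hx₀⟩ := hC₀.1.nonempty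
    refine Finset.card_pos.2 ⟨x₀, ?_⟩
    rw [Finset.mem_filter, Set.Finite.mem_toFinset]
    exact ⟨hC₀.1.subset_ground hx₀, hC₀.1.not_isColoop_of_mem hx₀⟩
  by_contra hno
  push Not at hno
  have hall : ∀ x ∈ M.ground_finite.toFinset.filter (fun x => ¬ M.IsColoop x),
      6 * {C : Set α | M.IsCircuit C ∧ C.ncard = 6}.ncard /
        (M.ground_finite.toFinset.filter (fun x => ¬ M.IsColoop x)).card + 1 ≤
        {C : Set α | M.IsCircuit C ∧ C.ncard = 6 ∧ x ∈ C}.ncard := by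
    intro x hx
    have hx' := hx
    rw [Finset.mem_filter, Set.Finite.mem_toFinset] at hx'
    have := hno x hx'.1 hx'.2
    omega
  have hge := Finset.card_nsmul_le_sum _ _ _ hall
  rw [smul_eq_mul, hsum] at hge
  have hdm := Nat.div_add_mod (6 * {C : Set α | M.IsCircuit C ∧ C.ncard = 6}.ncard)
    (M.ground_finite.toFinset.filter (fun x => ¬ M.IsColoop x)).card
  have hmod := Nat.mod_lt (6 * {C : Set α | M.IsCircuit C ∧ C.ncard = 6}.ncard) hm
  have hmul : (M.ground_finite.toFinset.filter (fun x => ¬ M.IsColoop x)).card *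
      (6 * {C : Set α | M.IsCircuit C ∧ C.ncard = 6}.ncard /
        (M.ground_finite.toFinset.filter (fun x => ¬ M.IsColoop x)).card + 1) =
      (M.ground_finite.toFinset.filter (fun x => ¬ M.IsColoop x)).card *
      (6 * {C : Set α | M.IsCircuit C ∧ C.ncard = 6}.ncard /
        (M.ground_finite.toFinset.filter (fun x => ¬ M.IsColoop x)).card) +
      (M.ground_finite.toFinset.filter (fun x => ¬ M.IsColoop x)).card := by ring
  omega

/-- The arithmetic of the averaging step at size six: `s − ⌊6s/n⌋ ≤ B` with `n > 6` gives `s ≤ ⌊n·B/(n − 6)⌋`. -/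
theorem le_mul_div_of_sub_div_le_six {s B m : ℕ} (hm : 6 < m) (h : s - 6 * s / m ≤ B) :
    s ≤ m * B / (m - 6) := by
  have h1 : s ≤ B + 6 * s / m := by omega
  have h2 : m * (6 * s / m) ≤ 6 * s := Nat.mul_div_le (6 * s) m
  have h3 : m * s ≤ m * B + 6 * s := by nlinarith [Nat.mul_le_mul_left m h1]
  have h4 : (m - 6) * s ≤ m * B := by
    have : (m - 6) * s = m * s - 6 * s := by rw [Nat.sub_mul]
    omega
  exact (Nat.le_div_iff_mul_le (by omega)).2 (by rw [mul_comm]; exact h4)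


/-- **The six-circuits through a point are at most `C(ν + 4, 5)`** on a finite matroid of nullity `ν`: they contract to distinct
five-circuits of `M ／ {e}`, a matroid of the same nullity (`nullity_contract_singleton_of_not_isLoop`). -/
theorem ncard_sixCircuitsThrough_le_choose (M : Matroid α) [M.Finite] {d : ℕ} (hd : M.E.encard = M.eRank + d) (e : α) :
    {C : Set α | M.IsCircuit C ∧ C.ncard = 6 ∧ e ∈ C}.ncard ≤ (d + 4).choose 5 := by
  classical
  set S₁ := {C : Set α | M.IsCircuit C ∧ C.ncard = 6 ∧ e ∈ C} with hS₁
  by_cases hempty : S₁ = ∅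
  · rw [hempty, ncard_empty]; exact Nat.zero_le _
  obtain ⟨C₀, hC₀⟩ := nonempty_iff_ne_empty.2 hempty
  have heE : e ∈ M.E := hC₀.1.subset_ground hC₀.2.2
  have hel : ¬ M.IsLoop e := by
    intro hl
    have h6 := hC₀.2.1
    rw [hl.eq_of_isCircuit_mem hC₀.1 hC₀.2.2, ncard_singleton] at h6
    exact absurd h6 (by norm_num)
  have hdN := nullity_contract_singleton_of_not_isLoop M heE hel hd
  set S₂ := {C : Set α | (M ／ {e}).IsCircuit C ∧ C.ncard = 4 + 1} with hS₂
  have hS₂fin : S₂.Finite :=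
    (M ／ {e}).ground_finite.finite_subsets.subset (fun C hC => hC.1.subset_ground)
  have hmap : ∀ C ∈ S₁, C \ {e} ∈ S₂ := by
    intro C hC
    have hCfin : C.Finite := M.ground_finite.subset hC.1.subset_ground
    have hnt : C.Nontrivial := by
      have : Finite C := hCfin.to_subtype
      rw [← Set.one_lt_ncard_iff_nontrivial, hC.2.1]; norm_num
    refine ⟨hC.1.contractElem_isCircuit hnt hC.2.2, ?_⟩
    rw [Set.ncard_sdiff_singleton_of_mem hC.2.2, hC.2.1]
  have hinj : Set.InjOn (fun C : Set α => C \ {e}) S₁ := by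
    intro C hC C' hC' h
    simp only at h
    have h1 : C = insert e (C \ {e}) := by
      rw [Set.insert_sdiff_singleton, Set.insert_eq_of_mem hC.2.2]
    have h2 : C' = insert e (C' \ {e}) := by
      rw [Set.insert_sdiff_singleton, Set.insert_eq_of_mem hC'.2.2]
    rw [h1, h2, h]
  calc S₁.ncard ≤ S₂.ncard := Set.ncard_le_ncard_of_injOn _ hmap hinj hS₂fin
    _ ≤ (d + 4).choose (4 + 1) := PercRepro.Matroid.ncard_circuits_le_choose_of_encard (M ／ {e}) hdN 4

end S1

end PercRepro
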